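/-
Copyright (c) 2026 the pub-hodgecm-mathlib formalisation cell (harness21).  Prover seat hodgecm-mathlib-A-p19 (g28): «S3-ram» seeding wave (LEAD F0P3a-plan (g13);
owner F0P3a-p06 (g15); (Cnt2′) chair F0P3a-p07 (g14)), row (z4-i) «the BLOCK FRAME of the opposite literal» paired with A-p12 (g24); 2026-09-02.
-/
import Literature.NumberTheory.Rogawski1990.TypeTwoAnisotropicLiteralRamified      -- ★ p847752 (this seat): `exists_anisotropicBlock_ram`, `det_endoForm`, `oneByOne_map_transpose`, `oneByOne_map_transpose_mul_mul`, `endoForm_apply_one_one`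
import Literature.NumberTheory.QuadraticForms.HermitianUnimodularPlaneValuedField    -- (this seat) `exists_isIntMatrix_formCongr_eq_diagonal`, `valued_add_mul_norm_eq_one_of_not_norm`, `det_formCongr_eq`, `diagonal_map_transpose_of_forall`
import Literature.NumberTheory.Automorphic.UnitaryLatticeTreeAxisEndoFrame          -- ★ `endoGL_inv_mul_endoGL_mul_endoGL`; brings ★ `isIntMatrix_mul`, `isIntMatrix_transpose_map`, `v_det_eq_one_of_isIntMatrix_inv`
import HarnessLib

/-!
# The opposite-sign 2-deep literal at a TAMELY RAMIFIED CM place, III: an integrally DIAGONAL block frame `Y = P·ι(γ₁, u)·P⁻¹`, `ᵗσ̄P·J₀·P = ι-shape(diag d, η)`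
# with `diag d` residually anisotropic (Rogawski 1990 §3.5–§3.6, §4.9; Jacobowitz 1962 §8; Labesse–Langlands 1979 §2)

Topic `NumberTheory/Rogawski1990`; namespace `Literature.NumberTheory.Rogawski1990`.  THEOREMS ONLY (no definition, no instance, no notation, no named fact, no `sorry`); kernel lane
`--supports stmt-HodgeConjecture-24833`.  Cell `pub/hodgecm-mathlib` (D-0151), crux H413; road «S3-ram», fold `LocalTransferAtOneTameRamified` (fold pen F0P3-p02 (g17)), row **(z4-i)**
of the (Cnt2′) chair's roadmap (F0P3a-p07 (g14), rulings (5) 02:25:51Z ∕ (6) 02:39:51Z): the literal `Y` of ★ `exists_anisotropicLiteral_ram` (part II) RE-FRAMED so that its Gram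
matrix is the `ι`-shape of a DIAGONAL plane — the currency `(hd) (hanis₀) (hanis₁)` of ★ `UnitaryLatticeTreeAnisotropicAxisCount` ((z1-e′), the anisotropic axis count is an
indicator) and of the lattice-currency sockets ★ p847724 consumed by A-p12 (g24)'s (z4-ii) assembly head.
HONEST LABEL: HC_CM is proved only modulo the cell's 2 remaining named inputs (hLiu418 24832, h413 24833) until rung 0 closes; unconditional local algebra, count-neutral.

THE MATHEMATICS.  Part II produced `G₁ ∈ U(Ψ)` for a UNIMODULAR σ-hermitian integral plane `Ψ` whose class `η = (−det Ψ)⁻¹` is a σ-fixed unit which is NOT a norm.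
* The engine (place-free, ★ `QuadraticForms.HermitianUnimodularPlaneValuedField`, this seat): every unimodular σ-hermitian integral `2 × 2` matrix over a discretely valued field with
  `|2| = 1` is INTEGRALLY congruent to `diag(d₀, d₁)` (`E, E⁻¹` integral, `dᵢ` σ-fixed units), and `diag(d₀, d₁)` is residually anisotropic as soon as `−d₀d₁` is not a norm.
* §1 `endoForm_oneByOne_eq`: `endoForm J₂ (h)` IS the printed `ι`-shape `!![…]` of (z1-e′).
* §2 (the CM place): `exists_anisotropicDiagonalBlock_ram` — `γ₁ := E⁻¹G₁E ∈ U(diag d)`, still `≡ 1 (mod ϖ²)` (`E ∈ GL₂(𝒪)`), `ι(γ₁, u) ∼ ι(g, u)` in `GL₃(L_w)` (★ `endoGL_inv_mul_endoGL_mul_endoGL`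
  and part II's cyclic frame), `diag d` residually anisotropic (`−d₀d₁ = −det Ψ·N(det E) ∉ N` since `η ∉ N`), and `σ(det E)·det E = −det ι-shape(diag d, η)`; then
  **`exists_anisotropicLiteral_frame_ram`** — part II's conclusion VERBATIM (`Y ∈ U(σ_w, J₀)` 2-deep, `GL₃`-conjugate to `endoGL(g, u)`, `u`-eigenvector `q` of NON-NORM length `η`) PLUS the
  frame: `P ∈ GL₃(𝒪_w)` (★ p846940 on `ι-shape(diag d, η)`, whose `−det` is the norm `N(det E)`), `ᵗσ̄P·J₀·P = ι-shape(diag d, η)` as the printed `!![…]` literal of (z1-e′), `|dᵢ| = 1`,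
  `σdᵢ = dᵢ`, the two anisotropy clauses, `γ₁ ≡ 1 (mod ϖ²)`, `γ₁ ∈ U(σ_w, diag d)`, and `Y = P·endoGL(γ₁, u)·P⁻¹` ON THE NOSE.

## References
* [Rogawski1990] J. D. Rogawski, *Automorphic Representations of Unitary Groups in Three Variables*, Ann. of Math. Stud. 123 (1990), §3.5 Prop. 3.5.2 (a)(c) p. 29, §3.6 p. 31,
  §4.8 Case (a) p. 53, §4.9 Prop. 4.9.1 p. 55.
* [Jacobowitz1962] R. Jacobowitz, *Hermitian forms over local fields*, Amer. J. Math. 84 (1962), §4, §7 Thm. 7.1, §8 (ramified non-dyadic: orthogonal bases).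
* [Omeara1963] O. T. O'Meara, *Introduction to Quadratic Forms* (1963), §92:1 (unimodular lattices at odd residue characteristic have orthogonal bases).
* [LabesseLanglands1979] J.-P. Labesse, R. P. Langlands, *L-indistinguishability for SL(2)*, Canad. J. Math. 31 (1979), §2 pp. 8–10.
* [Serre1979] J.-P. Serre, *Local Fields*, GTM 67 (1979), Ch. V §3 (norms of units, tame case).
-/

set_option autoImplicit false

noncomputable section

open NumberField IsDedekindDomain Matrix Polynomial
open Literature.NumberTheory.Automorphic Literature.NumberTheory.Automorphic.UnitaryGroup Literature.NumberTheory.Automorphic.UnitaryLatticeTree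
open Literature.NumberTheory.GaloisRepresentations
open Literature.NumberTheory.LocalFields.UnramifiedQuadraticNorm
open Literature.NumberTheory.LocalFields.RamifiedPlaceNormDictionary Literature.NumberTheory.LocalFields.RamifiedPlaceUnitNorms
open Literature.NumberTheory.QuadraticForms.HermitianUnimodularValued
open scoped MatrixGroups ValuativeRel

namespace Literature.NumberTheory.Rogawski1990

/-! ## §1 The `ι`-shape literal -/

section Algebra

variable {K : Type*} [Field K]

/-- `endoForm J₂ (h)` is the printed `ι`-shape `!![J₂₀₀, 0, J₂₀₁; 0, h, 0; J₂₁₀, 0, J₂₁₁]` (the currency of ★ `UnitaryLatticeTreeAnisotropicAxisCount`). [cite: Rogawski1990, §4.8 Case (a) p. 53] -/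
theorem endoForm_oneByOne_eq (J₂ : Matrix (Fin 2) (Fin 2) K) (h : K) :
    endoForm J₂ !![h] = !![J₂ 0 0, 0, J₂ 0 1; 0, h, 0; J₂ 1 0, 0, J₂ 1 1] := by
  rw [endoForm_eq]; rfl

end Algebra

/-! ## §2 The CM place: the diagonal block frame of the anisotropic literal -/

section CM

variable (L : Type) [Field L] [NumberField L] [IsCMField L] {v : HeightOneSpectrum (𝓞 ↥(maximalRealSubfield L))}
  (w : PlacesOver L v) (hw : IsCMField.complexConj L • w.1 = w.1)

include hw in
/-- **THE ANISOTROPIC BLOCK IN A DIAGONAL FRAME.**  Same hypotheses as ★ `exists_anisotropicBlock_ram` (tame-ramified non-split `w`, `|2|_w = 1`, anti-fixed uniformiser `ϖ`,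
`g ∈ U(Φ₂)` rootless and `≡ 1 (mod ϖ²)`): there are `γ₁ ∈ GL₂(L_w)`, a DIAGONAL plane `diag(d₀, d₁)` and scalars `η, c` with — `γ₁ ≡ 1 (mod ϖ²)`; `ι(γ₁, u) ∼ ι(g, u)` in `GL₃(L_w)`
for every `u`; the column facts of the pattern; `γ₁ ∈ U(σ_w, diag d)`; `|dᵢ| = 1`, `σdᵢ = dᵢ`; `diag d` RESIDUALLY ANISOTROPIC (both clauses of ★ `UnitaryLatticeTreeAnisotropicAxisCount`);
`η` a σ-fixed unit which is NOT a norm; and `σc·c = −det(diag d)·η` (so `−det ι-shape(diag d, η)` is a norm).  (`γ₁ = E⁻¹G₁E` for the integral diagonalisation `E` of part II's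
plane `Ψ`, §1; `c = det E`; anisotropy since `−d₀d₁ = −det Ψ·N(det E)` is a non-norm like `η = (−det Ψ)⁻¹`.)
[cite: Rogawski1990, §3.5 Prop. 3.5.2 (a)(c) p. 29; §3.6 p. 31] [cite: Jacobowitz1962, §8] [cite: LabesseLanglands1979, §2 pp. 8–10] -/
theorem exists_anisotropicDiagonalBlock_ram (he : v.asIdeal.ramificationIdx' w.1.asIdeal ≠ 1) (h2 : Valued.v (2 : (w.1.adicCompletion L)) = 1)
    {ϖ : (w.1.adicCompletion L)} (hϖ : Valued.v ϖ = WithZero.exp (-1 : ℤ)) (hσϖ : galAdicCompletionMap (L := L) (IsCMField.complexConj L) hw ϖ = -ϖ)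
    (g : GL (Fin 2) (w.1.adicCompletion L)) (hgU : g ∈ unitaryGroupOfForm (galAdicCompletionMap (L := L) (IsCMField.complexConj L) hw) !![(0 : (w.1.adicCompletion L)), 1; 1, 0])
    (hA : ∀ x : (w.1.adicCompletion L), (g : Matrix (Fin 2) (Fin 2) (w.1.adicCompletion L)).charpoly.eval x ≠ 0)
    (hg2 : ∀ i j, Valued.v (((g : Matrix (Fin 2) (Fin 2) (w.1.adicCompletion L)) - 1) i j) ≤ Valued.v (ϖ ^ 2)) :
    ∃ (G₁ : GL (Fin 2) (w.1.adicCompletion L)) (d : Fin 2 → (w.1.adicCompletion L)) (η c : (w.1.adicCompletion L)),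
      (∀ i j, Valued.v (((G₁ : Matrix (Fin 2) (Fin 2) (w.1.adicCompletion L)) - 1) i j) ≤ Valued.v (ϖ ^ 2)) ∧
      (∀ uu : GL (Fin 1) (w.1.adicCompletion L), IsConj (endoGL (G₁, uu)) (endoGL (g, uu))) ∧
      (∀ uu : GL (Fin 1) (w.1.adicCompletion L), ((endoGL (G₁, uu) : GL (Fin 3) (w.1.adicCompletion L)) : Matrix (Fin 3) (Fin 3) (w.1.adicCompletion L)) 1 1 = (uu : Matrix (Fin 1) (Fin 1) (w.1.adicCompletion L)) 0 0 ∧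
        ∀ i : Fin 3, i ≠ 1 → ((endoGL (G₁, uu) : GL (Fin 3) (w.1.adicCompletion L)) : Matrix (Fin 3) (Fin 3) (w.1.adicCompletion L)) i 1 = 0) ∧
      G₁ ∈ unitaryGroupOfForm (galAdicCompletionMap (L := L) (IsCMField.complexConj L) hw) (Matrix.diagonal d) ∧
      (∀ i, Valued.v (d i) = 1) ∧ (∀ i, galAdicCompletionMap (L := L) (IsCMField.complexConj L) hw (d i) = d i) ∧
      (∀ c' : (w.1.adicCompletion L), Valued.v c' ≤ 1 → Valued.v (d 0 + d 1 * (galAdicCompletionMap (L := L) (IsCMField.complexConj L) hw c' * c')) = 1) ∧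
      (∀ c' : (w.1.adicCompletion L), Valued.v c' ≤ 1 → Valued.v (d 0 * (galAdicCompletionMap (L := L) (IsCMField.complexConj L) hw c' * c') + d 1) = 1) ∧
      galAdicCompletionMap (L := L) (IsCMField.complexConj L) hw η = η ∧ Valued.v η = 1 ∧
      (¬ ∃ t : (w.1.adicCompletion L), t * galAdicCompletionMap (L := L) (IsCMField.complexConj L) hw t = η) ∧
      galAdicCompletionMap (L := L) (IsCMField.complexConj L) hw c * c = -((Matrix.diagonal d).det * η) := by
  set σ := galAdicCompletionMap (L := L) (IsCMField.complexConj L) hw with hσdef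
  have hc1 : IsCMField.complexConj L ≠ 1 := IsCMField.complexConj_ne_one L
  have hσσ : ∀ x, σ (σ x) = x := fun x => galAdicCompletionMap_galAdicCompletionMap_of_smul_eq (IsCMField.complexConj L) w hc1 hw x
  have hvσ : ∀ x, Valued.v (σ x) = Valued.v x := fun x => valued_galAdicCompletionMap (L := L) (IsCMField.complexConj L) hw x
  obtain ⟨-, -, -, -, hnorm⟩ := ramifiedBlock_adicCompletion L v w hw he h2
  have hnorm' : ∀ u : (w.1.adicCompletion L), σ u = u → Valued.v (u - 1) < 1 → ∃ z : (w.1.adicCompletion L), z * σ z = u := fun u hu h1 => by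
    obtain ⟨z, hz, -⟩ := hnorm u hu h1
    exact ⟨z, hz⟩
  obtain ⟨C, G₁, Ψ, η, hG₁2, hinter, -, hG₁U, hΨh, hΨint, hvΨdet, hηdef, hση, hvη, hηN⟩ :=
    exists_anisotropicBlock_ram L w hw he h2 hϖ hσϖ g hgU hA hg2
  have hΨdet0 : Ψ.det ≠ 0 := fun h0 => by rw [h0, map_zero] at hvΨdet; exact zero_ne_one hvΨdet
  -- §1: the integral diagonalisation `ᵗσ̄EΨE = diag d`
  obtain ⟨E, d, hEint, hEiint, hEΨ, hd, hσd⟩ := exists_isIntMatrix_formCongr_eq_diagonal hσσ hvσ h2 hΨh hΨint hvΨdet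
  have hdetd : (Matrix.diagonal d).det = Ψ.det * ((E : Matrix (Fin 2) (Fin 2) (w.1.adicCompletion L)).det * σ (E : Matrix (Fin 2) (Fin 2) (w.1.adicCompletion L)).det) := by
    rw [← hEΨ]; exact det_formCongr_eq σ E Ψ
  have hd01 : (Matrix.diagonal d).det = d 0 * d 1 := by rw [Matrix.det_diagonal, Fin.prod_univ_two]
  have hvdetE : Valued.v (E : Matrix (Fin 2) (Fin 2) (w.1.adicCompletion L)).det = 1 := v_det_eq_one_of_isIntMatrix_inv hEint hEiint
  have hdetE0 : (E : Matrix (Fin 2) (Fin 2) (w.1.adicCompletion L)).det ≠ 0 := fun h0 => by rw [h0, map_zero] at hvdetE; exact zero_ne_one hvdetE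
  have hσdetE0 : σ (E : Matrix (Fin 2) (Fin 2) (w.1.adicCompletion L)).det ≠ 0 := fun h0 => by
    rw [← hvσ, h0, map_zero] at hvdetE; exact zero_ne_one hvdetE
  -- the block in the diagonal frame
  obtain ⟨G₁', hG₁'def⟩ : ∃ G₁' : GL (Fin 2) (w.1.adicCompletion L), G₁' = E⁻¹ * G₁ * E := ⟨_, rfl⟩
  have hG₁'U : G₁' ∈ unitaryGroupOfForm σ (Matrix.diagonal d) := by
    rw [← hEΨ, ← conj_mem_unitaryGroupOfForm_iff σ E Ψ G₁', hG₁'def, mul_assoc E⁻¹ G₁ E, mul_inv_cancel_left, mul_inv_cancel_right]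
    exact hG₁U
  have hG₁'2 : ∀ i j, Valued.v (((G₁' : Matrix (Fin 2) (Fin 2) (w.1.adicCompletion L)) - 1) i j) ≤ Valued.v (ϖ ^ 2) := by
    have h := valued_conj_sub_one_le E hEint hEiint (G₁ : Matrix (Fin 2) (Fin 2) (w.1.adicCompletion L)) hG₁2
    rw [hG₁'def, Units.val_mul, Units.val_mul]
    exact h
  have hconj : ∀ uu : GL (Fin 1) (w.1.adicCompletion L), IsConj (endoGL (G₁', uu)) (endoGL (g, uu)) := by
    intro uu
    have h1 : IsConj (endoGL (G₁', uu)) (endoGL (G₁, uu)) := by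
      refine isConj_iff.2 ⟨endoGL (E, (1 : GL (Fin 1) (w.1.adicCompletion L))), ?_⟩
      rw [hG₁'def, ← endoGL_inv_mul_endoGL_mul_endoGL E G₁ uu, mul_assoc (endoGL (E, (1 : GL (Fin 1) (w.1.adicCompletion L))))⁻¹, mul_inv_cancel_left,
        mul_inv_cancel_right]
    have h2' : IsConj (endoGL (G₁, uu)) (endoGL (g, uu)) :=
      ⟨toUnits (endoGL (C, (1 : GL (Fin 1) (w.1.adicCompletion L)))), by rw [SemiconjBy, val_toUnits_apply]; exact hinter uu⟩
    exact h1.trans h2'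
  have hcol : ∀ uu : GL (Fin 1) (w.1.adicCompletion L), ((endoGL (G₁', uu) : GL (Fin 3) (w.1.adicCompletion L)) : Matrix (Fin 3) (Fin 3) (w.1.adicCompletion L)) 1 1 = (uu : Matrix (Fin 1) (Fin 1) (w.1.adicCompletion L)) 0 0 ∧
      ∀ i : Fin 3, i ≠ 1 → ((endoGL (G₁', uu) : GL (Fin 3) (w.1.adicCompletion L)) : Matrix (Fin 3) (Fin 3) (w.1.adicCompletion L)) i 1 = 0 := by
    intro uu
    refine ⟨by rw [coe_endoGL_eq]; rfl, fun i hi => ?_⟩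
    rw [coe_endoGL_eq]
    fin_cases i
    · rfl
    · exact absurd rfl hi
    · rfl
  -- residual anisotropy: `−d₀d₁ = −det Ψ · N(det E)` is a non-norm since `η = (−det Ψ)⁻¹` is
  have hN : ¬ ∃ t : (w.1.adicCompletion L), t * σ t = -(d 0 * d 1) := by
    rintro ⟨t, ht⟩
    rw [← hd01, hdetd] at ht
    have ht0 : t ≠ 0 := by
      rintro rfl
      rw [zero_mul] at ht
      exact neg_ne_zero.2 (mul_ne_zero hΨdet0 (mul_ne_zero hdetE0 hσdetE0)) ht.symm
    have hσt0 : σ t ≠ 0 := fun h0 => by rw [← map_zero σ] at h0; exact ht0 (σ.injective h0)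
    refine hηN ⟨(E : Matrix (Fin 2) (Fin 2) (w.1.adicCompletion L)).det * t⁻¹, ?_⟩
    have hb0 : (E : Matrix (Fin 2) (Fin 2) (w.1.adicCompletion L)).det * σ (E : Matrix (Fin 2) (Fin 2) (w.1.adicCompletion L)).det ≠ 0 := mul_ne_zero hdetE0 hσdetE0
    calc (E : Matrix (Fin 2) (Fin 2) (w.1.adicCompletion L)).det * t⁻¹ * σ ((E : Matrix (Fin 2) (Fin 2) (w.1.adicCompletion L)).det * t⁻¹)
        = ((E : Matrix (Fin 2) (Fin 2) (w.1.adicCompletion L)).det * σ (E : Matrix (Fin 2) (Fin 2) (w.1.adicCompletion L)).det) * (t * σ t)⁻¹ := by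
          rw [map_mul, map_inv₀, mul_inv]; ring
      _ = (-Ψ.det)⁻¹ := by
          rw [ht, ← neg_mul, mul_inv, ← mul_assoc, mul_comm _ ((-Ψ.det)⁻¹), mul_assoc, mul_inv_cancel₀ hb0, mul_one]
      _ = η := hηdef.symm
  have hanis₀ : ∀ c' : (w.1.adicCompletion L), Valued.v c' ≤ 1 → Valued.v (d 0 + d 1 * (σ c' * c')) = 1 :=
    valued_add_mul_norm_eq_one_of_not_norm hσσ hvσ hnorm' (hσd 0) (hσd 1) (hd 0) (hd 1) hN
  have hanis₁ : ∀ c' : (w.1.adicCompletion L), Valued.v c' ≤ 1 → Valued.v (d 0 * (σ c' * c') + d 1) = 1 :=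
    valued_mul_norm_add_eq_one_of_not_norm hσσ hvσ hnorm' (hσd 0) (hσd 1) (hd 0) (hd 1) hN
  -- `c = det E`: `σ(det E)·det E = −det(diag d)·η`
  have hc : σ (E : Matrix (Fin 2) (Fin 2) (w.1.adicCompletion L)).det * (E : Matrix (Fin 2) (Fin 2) (w.1.adicCompletion L)).det = -((Matrix.diagonal d).det * η) := by
    rw [hdetd, hηdef, inv_neg, mul_neg, neg_neg, mul_comm Ψ.det, mul_inv_cancel_right₀ hΨdet0, mul_comm]
  exact ⟨G₁', d, η, _, hG₁'2, hconj, hcol, hG₁'U, hd, hσd, hanis₀, hanis₁, hση, hvη, hηN, hc⟩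

include hw in
/-- **THE ANISOTROPIC LITERAL WITH ITS DIAGONAL BLOCK FRAME** ((z4-i) for ★ `exists_anisotropicLiteral_ram`): under that theorem's hypotheses VERBATIM, its conclusion VERBATIM
(`Y ∈ U(σ_w, J₀)`, `Y ≡ 1 (mod ϖ²)`, `ι(g, u) ∼ Y`, `Y·q = u·q`, `q ≠ 0`, `ℓ_{J₀}(q) = η` a σ-fixed unit NON-norm) AND the frame: `P ∈ GL₃(𝒪_w)` with
`ᵗσ̄P·J₀·P = ι-shape(diag d, η)` (the printed `!![…]` of ★ `UnitaryLatticeTreeAnisotropicAxisCount`), `|dᵢ| = 1`, `σdᵢ = dᵢ`, `diag d` residually anisotropic (both clauses),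
`γ₁ ≡ 1 (mod ϖ²)`, `γ₁ ∈ U(σ_w, diag d)`, and `Y = P·endoGL(γ₁, u)·P⁻¹` on the nose.  (`P` = ★ p846940 on `ι-shape(diag d, η)`, whose `−det` is the norm `N(det E)`;
`q = P e₁`.) [cite: Rogawski1990, §3.5 Prop. 3.5.2 (a)(c) p. 29; §3.6 p. 31; §4.9 Prop. 4.9.1 p. 55] [cite: Jacobowitz1962, §8] [cite: LabesseLanglands1979, §2 pp. 8–10] -/
theorem exists_anisotropicLiteral_frame_ram (he : v.asIdeal.ramificationIdx' w.1.asIdeal ≠ 1) (h2 : Valued.v (2 : (w.1.adicCompletion L)) = 1)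
    {ϖ : (w.1.adicCompletion L)} (hϖ : Valued.v ϖ = WithZero.exp (-1 : ℤ)) (hσϖ : galAdicCompletionMap (L := L) (IsCMField.complexConj L) hw ϖ = -ϖ)
    (g : GL (Fin 2) (w.1.adicCompletion L)) (hgU : g ∈ unitaryGroupOfForm (galAdicCompletionMap (L := L) (IsCMField.complexConj L) hw) !![(0 : (w.1.adicCompletion L)), 1; 1, 0])
    (hA : ∀ x : (w.1.adicCompletion L), (g : Matrix (Fin 2) (Fin 2) (w.1.adicCompletion L)).charpoly.eval x ≠ 0)
    (hg2 : ∀ i j, Valued.v (((g : Matrix (Fin 2) (Fin 2) (w.1.adicCompletion L)) - 1) i j) ≤ Valued.v (ϖ ^ 2))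
    (uu : GL (Fin 1) (w.1.adicCompletion L)) (hu1 : galAdicCompletionMap (L := L) (IsCMField.complexConj L) hw ((uu : Matrix (Fin 1) (Fin 1) (w.1.adicCompletion L)) 0 0) * ((uu : Matrix (Fin 1) (Fin 1) (w.1.adicCompletion L)) 0 0) = 1) (hu2 : Valued.v (((uu : Matrix (Fin 1) (Fin 1) (w.1.adicCompletion L)) 0 0) - 1) ≤ Valued.v (ϖ ^ 2)) :
    ∃ (Y : GL (Fin 3) (w.1.adicCompletion L)) (q : Fin 3 → (w.1.adicCompletion L)) (η : (w.1.adicCompletion L))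
      (P : GL (Fin 3) (w.1.adicCompletion L)) (d : Fin 2 → (w.1.adicCompletion L)) (γ₁ : GL (Fin 2) (w.1.adicCompletion L)),
      Y ∈ unitaryGroupOfForm (galAdicCompletionMap (L := L) (IsCMField.complexConj L) hw) ((StdForm.antidiagonal 3).over (w.1.adicCompletion L)) ∧
      (∀ i j, Valued.v (((Y : Matrix (Fin 3) (Fin 3) (w.1.adicCompletion L)) - 1) i j) ≤ Valued.v (ϖ ^ 2)) ∧
      IsConj (endoGL (g, uu)) Y ∧
      (Y : Matrix (Fin 3) (Fin 3) (w.1.adicCompletion L)) *ᵥ q = ((uu : Matrix (Fin 1) (Fin 1) (w.1.adicCompletion L)) 0 0) • q ∧ q ≠ 0 ∧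
      (∑ i : Fin 3, ∑ k : Fin 3, galAdicCompletionMap (L := L) (IsCMField.complexConj L) hw (q i) * (StdForm.antidiagonal 3).over (w.1.adicCompletion L) i k * q k) = η ∧
      galAdicCompletionMap (L := L) (IsCMField.complexConj L) hw η = η ∧ Valued.v η = 1 ∧ (¬ ∃ t : (w.1.adicCompletion L), t * galAdicCompletionMap (L := L) (IsCMField.complexConj L) hw t = η) ∧
      P ∈ glInt 3 (w.1.adicCompletion L) ∧
      formCongr (galAdicCompletionMap (L := L) (IsCMField.complexConj L) hw) P ((StdForm.antidiagonal 3).over (w.1.adicCompletion L)) =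
        !![(Matrix.diagonal d) 0 0, 0, (Matrix.diagonal d) 0 1; 0, η, 0; (Matrix.diagonal d) 1 0, 0, (Matrix.diagonal d) 1 1] ∧
      (∀ i, Valued.v (d i) = 1) ∧ (∀ i, galAdicCompletionMap (L := L) (IsCMField.complexConj L) hw (d i) = d i) ∧
      (∀ c : (w.1.adicCompletion L), Valued.v c ≤ 1 → Valued.v (d 0 + d 1 * (galAdicCompletionMap (L := L) (IsCMField.complexConj L) hw c * c)) = 1) ∧
      (∀ c : (w.1.adicCompletion L), Valued.v c ≤ 1 → Valued.v (d 0 * (galAdicCompletionMap (L := L) (IsCMField.complexConj L) hw c * c) + d 1) = 1) ∧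
      (∀ i j, Valued.v (((γ₁ : Matrix (Fin 2) (Fin 2) (w.1.adicCompletion L)) - 1) i j) ≤ Valued.v (ϖ ^ 2)) ∧
      γ₁ ∈ unitaryGroupOfForm (galAdicCompletionMap (L := L) (IsCMField.complexConj L) hw) (Matrix.diagonal d) ∧
      Y = P * endoGL (γ₁, uu) * P⁻¹ := by
  set σ := galAdicCompletionMap (L := L) (IsCMField.complexConj L) hw with hσdef
  obtain ⟨G₁, d, η, c, hG₁2, hconjg, hcol, hG₁U, hd, hσd, hanis₀, hanis₁, hση, hvη, hηN, hc⟩ :=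
    exists_anisotropicDiagonalBlock_ram L w hw he h2 hϖ hσϖ g hgU hA hg2
  -- the `3 × 3` dress `H₃ = diag d ⊥ (η)` and the integral isometry `P`
  obtain ⟨H₃, hH₃def⟩ : ∃ H₃ : Matrix (Fin 3) (Fin 3) (w.1.adicCompletion L), H₃ = endoForm (Matrix.diagonal d) !![η] := ⟨_, rfl⟩
  have hH₃h : (H₃.map σ)ᵀ = H₃ := by
    rw [hH₃def, endoForm_map_transpose, diagonal_map_transpose_of_forall σ hσd, oneByOne_map_transpose σ hση]
  have hH₃int : IsIntMatrix H₃ := by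
    intro i j
    rw [hH₃def, endoForm_eq]
    fin_cases i <;> fin_cases j <;> simp
    all_goals first | exact (hd 0).le | exact hvη.le | exact (hd 1).le
  have hH₃det : H₃.det = (Matrix.diagonal d).det * η := by rw [hH₃def, det_endoForm, Matrix.det_fin_one_of]
  have hvH₃det : Valued.v H₃.det = 1 := by
    rw [hH₃det, Matrix.det_diagonal, Fin.prod_univ_two, map_mul, map_mul, hd 0, hd 1, hvη, one_mul, one_mul]
  have hc' : σ c * c = -H₃.det := by rw [hH₃det]; exact hc
  obtain ⟨P, hPint, hPform⟩ := exists_glInt_formCongr_antidiagonal_eq_of_map_mul_self_eq_neg_det_adicCompletion L w hw he h2 hH₃h hH₃int hvH₃det hc'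
  have hPi : ∀ a b, Valued.v ((P : Matrix (Fin 3) (Fin 3) (w.1.adicCompletion L)) a b) ≤ 1 := fun a b =>
    (v_le_one_iff_mem_integer _).2 (((mem_glInt_iff P).1 hPint).1 a b)
  have hPii : ∀ a b, Valued.v (((P⁻¹ : GL (Fin 3) (w.1.adicCompletion L)) : Matrix (Fin 3) (Fin 3) (w.1.adicCompletion L)) a b) ≤ 1 := fun a b =>
    (v_le_one_iff_mem_integer _).2 (((mem_glInt_iff P).1 hPint).2 a b)
  -- `uu ∈ U(η)` and the literal `W = ι(γ₁, u) ∈ U(H₃)`, `Y = P W P⁻¹ ∈ U(J₀)`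
  have huumat : (uu : Matrix (Fin 1) (Fin 1) (w.1.adicCompletion L)) = !![((uu : Matrix (Fin 1) (Fin 1) (w.1.adicCompletion L)) 0 0)] := by
    ext i j; fin_cases i; fin_cases j; rfl
  have huU : uu ∈ unitaryGroupOfForm σ !![η] := by
    rw [mem_unitaryGroupOfForm_iff, huumat]
    exact oneByOne_map_transpose_mul_mul σ η hu1
  obtain ⟨W, hWdef⟩ : ∃ W : GL (Fin 3) (w.1.adicCompletion L), W = endoGL (G₁, uu) := ⟨_, rfl⟩
  have hWU : W ∈ unitaryGroupOfForm σ H₃ := by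
    rw [hWdef, hH₃def]; exact (endoGL_mem_iff σ (Matrix.diagonal d) !![η] G₁ uu).2 ⟨hG₁U, huU⟩
  obtain ⟨Y, hYdef⟩ : ∃ Y : GL (Fin 3) (w.1.adicCompletion L), Y = P * W * P⁻¹ := ⟨_, rfl⟩
  have hYU : Y ∈ unitaryGroupOfForm σ ((StdForm.antidiagonal 3).over (w.1.adicCompletion L)) := by
    rw [hYdef]
    exact (conj_mem_unitaryGroupOfForm_iff σ P _ W).2 (by rw [hPform]; exact hWU)
  -- 2-depth: `W − 1` is the pattern of `(γ₁ − 1, u − 1)`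
  obtain ⟨hW11, hWi1⟩ := hcol uu
  have hW2 : ∀ i j, Valued.v (((W : Matrix (Fin 3) (Fin 3) (w.1.adicCompletion L)) - 1) i j) ≤ Valued.v (ϖ ^ 2) := by
    have h := valued_endoPattern_sub_one_le (a := (G₁ : Matrix (Fin 2) (Fin 2) (w.1.adicCompletion L)) 0 0) (b := (G₁ : Matrix (Fin 2) (Fin 2) (w.1.adicCompletion L)) 0 1)
      (c' := (G₁ : Matrix (Fin 2) (Fin 2) (w.1.adicCompletion L)) 1 0) (d := (G₁ : Matrix (Fin 2) (Fin 2) (w.1.adicCompletion L)) 1 1) (u := ((uu : Matrix (Fin 1) (Fin 1) (w.1.adicCompletion L)) 0 0)) (cc := ϖ ^ 2) ?_ hu2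
    · rw [hWdef, coe_endoGL_eq]; exact h
    · have e : (!![(G₁ : Matrix (Fin 2) (Fin 2) (w.1.adicCompletion L)) 0 0, (G₁ : Matrix (Fin 2) (Fin 2) (w.1.adicCompletion L)) 0 1; (G₁ : Matrix (Fin 2) (Fin 2) (w.1.adicCompletion L)) 1 0,
          (G₁ : Matrix (Fin 2) (Fin 2) (w.1.adicCompletion L)) 1 1] : Matrix (Fin 2) (Fin 2) (w.1.adicCompletion L)) = (G₁ : Matrix (Fin 2) (Fin 2) (w.1.adicCompletion L)) := by
        ext i j; fin_cases i <;> fin_cases j <;> rfl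
      rw [e]; exact hG₁2
  have hY2 : ∀ i j, Valued.v (((Y : Matrix (Fin 3) (Fin 3) (w.1.adicCompletion L)) - 1) i j) ≤ Valued.v (ϖ ^ 2) := by
    have h := valued_conj_sub_one_le (P⁻¹) hPii (by rw [inv_inv]; exact hPi) (W : Matrix (Fin 3) (Fin 3) (w.1.adicCompletion L)) hW2
    rw [inv_inv] at h
    rw [hYdef, Units.val_mul, Units.val_mul]
    exact h
  -- conjugacy with the pattern
  have hconj : IsConj (endoGL (g, uu)) Y := by
    have h1 : IsConj W (endoGL (g, uu)) := by rw [hWdef]; exact hconjg uu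
    have h2' : IsConj W Y := isConj_iff.2 ⟨P, hYdef.symm⟩
    exact h1.symm.trans h2'
  -- the eigenvector `q = P e₁` and its length `η`
  obtain ⟨qv, hqvdef⟩ : ∃ qv : Fin 3 → (w.1.adicCompletion L), qv = fun i => (P : Matrix (Fin 3) (Fin 3) (w.1.adicCompletion L)) i 1 := ⟨_, rfl⟩
  have hqP : (P : Matrix (Fin 3) (Fin 3) (w.1.adicCompletion L)) *ᵥ (Pi.single 1 1 : Fin 3 → (w.1.adicCompletion L)) = qv := by
    rw [Matrix.mulVec_single_one, hqvdef]; funext i; rw [Matrix.col_apply]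
  have hWe : (W : Matrix (Fin 3) (Fin 3) (w.1.adicCompletion L)) *ᵥ (Pi.single 1 1 : Fin 3 → (w.1.adicCompletion L)) = ((uu : Matrix (Fin 1) (Fin 1) (w.1.adicCompletion L)) 0 0) • (Pi.single 1 1 : Fin 3 → (w.1.adicCompletion L)) := by
    rw [Matrix.mulVec_single_one]
    funext i
    rw [Pi.smul_apply, smul_eq_mul, Matrix.col_apply, hWdef]
    by_cases hi : i = 1
    · rw [hi, hW11, Pi.single_eq_same, mul_one]
    · rw [hWi1 i hi, Pi.single_eq_of_ne hi, mul_zero]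
  have hPP : ((P⁻¹ : GL (Fin 3) (w.1.adicCompletion L)) : Matrix (Fin 3) (Fin 3) (w.1.adicCompletion L)) * (P : Matrix (Fin 3) (Fin 3) (w.1.adicCompletion L)) = 1 := by
    rw [← Units.val_mul, inv_mul_cancel, Units.val_one]
  have hYq : (Y : Matrix (Fin 3) (Fin 3) (w.1.adicCompletion L)) *ᵥ qv = ((uu : Matrix (Fin 1) (Fin 1) (w.1.adicCompletion L)) 0 0) • qv := by
    rw [← hqP, hYdef, Units.val_mul, Units.val_mul, Matrix.mulVec_mulVec, Matrix.mul_assoc, hPP, Matrix.mul_one, ← Matrix.mulVec_mulVec, hWe,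
      Matrix.mulVec_smul]
  have hq0 : qv ≠ 0 := by
    intro h0
    have h : ((P⁻¹ : GL (Fin 3) (w.1.adicCompletion L)) : Matrix (Fin 3) (Fin 3) (w.1.adicCompletion L)) *ᵥ ((P : Matrix (Fin 3) (Fin 3) (w.1.adicCompletion L)) *ᵥ (Pi.single 1 1 : Fin 3 → (w.1.adicCompletion L))) = 0 := by
      rw [hqP, h0, Matrix.mulVec_zero]
    rw [Matrix.mulVec_mulVec, hPP, Matrix.one_mulVec] at h
    have h1 := congr_fun h (1 : Fin 3)
    rw [Pi.single_eq_same, Pi.zero_apply] at h1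
    exact one_ne_zero h1
  have hlen : (∑ i : Fin 3, ∑ k : Fin 3, σ (qv i) * (StdForm.antidiagonal 3).over (w.1.adicCompletion L) i k * qv k) = η := by
    have h11 : formCongr σ P ((StdForm.antidiagonal 3).over (w.1.adicCompletion L)) 1 1 = η := by
      rw [hPform, hH₃def]; exact endoForm_apply_one_one (Matrix.diagonal d) η
    rw [← h11]
    simp only [formCongr, Matrix.mul_apply, Matrix.transpose_apply, Matrix.map_apply, Finset.sum_mul, hqvdef]
    rw [Finset.sum_comm]
  have hPform' : formCongr σ P ((StdForm.antidiagonal 3).over (w.1.adicCompletion L)) =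
      !![(Matrix.diagonal d) 0 0, 0, (Matrix.diagonal d) 0 1; 0, η, 0; (Matrix.diagonal d) 1 0, 0, (Matrix.diagonal d) 1 1] := by
    rw [hPform, hH₃def, endoForm_oneByOne_eq]
  have hYdef' : Y = P * endoGL (G₁, uu) * P⁻¹ := by rw [hYdef, hWdef]
  exact ⟨Y, qv, η, P, d, G₁, hYU, hY2, hconj, hYq, hq0, hlen, hση, hvη, hηN, hPint, hPform', hd, hσd, hanis₀, hanis₁, hG₁2, hG₁U, hYdef'⟩

end CM

end Literature.NumberTheory.Rogawski1990

end
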